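import Summits.BirchSwinnertonDyer.BirchSwinnertonDyer.Theorems.PrintCf2RamifiedOffTYZBlockFreeStructure
import Summits.BirchSwinnertonDyer.BirchSwinnertonDyer.Theorems.PrintCf2RamifiedOffTYZGeneratorDepthRhoOne
import HarnessLib

/-!
# Item 23431 (C⁺) — THE LOWER HALF ON THE BLOCK-FREE FAMILY BY NAME: its exact residual there is the INVISIBLE class `d(h) = 2`
# (crux stmt-BirchSwinnertonDyer-20509 `RamifiedOffTYZOfFacts`, line `offtyz-v7`, LEAD cruxlead-20509 g24, lineage cycle 25; sequel of
# `…RamifiedJumpOneTwoDividesOfWitness`, p782512; Theses-free)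

HONEST FRAMING (cell `bsd-print-cf2`, route `PrintCf2`; `--supports stmt-BirchSwinnertonDyer-20509`; THEOREMS ONLY — no `def`, no named fact, no `sorry`).
BSD is not proved by any of this; item 23431 and crux 20509 stay OPEN.

On the BLOCK-FREE family (square-free `n ≡ 7 (mod 8)` with no divisor `≡ 5 (mod 8)`, i.e. every prime factor `≡ ±1 (mod 8)`; `ℍ′_n = L_n(i)` by the
compositum sentence) the lower half `2 ∣ 𝓛(n)` of C⁺ holds, granted `tyz_cmPointCompositumData ∧ GZK`, for EVERY generator class of `A_n(ℚ)` modulo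
torsion EXCEPT the invisible one `d(h) = [X(h)] = [2]`:
* `X(h) ∈ ℚ^{×2}` ⟹ `ρ(n) = 1` (g18 `BlockFreeStructure.rhoIndex_eq_two_of_X_sq`) ⟹ `2 ∣ 𝓛(n)` (g18 `GeneratorDepth.two_dvd_scriptL_of_rhoIndex_eq_two_of_facts'`,
  no Selmer hypothesis);
* `X(h) ∉ ℚ^{×2} ∪ 2ℚ^{×2}` ⟹ `2 ∣ 𝓛(n)` (g16 `LowerHalfVisible.two_dvd_scriptL_of_visible_of_facts'`).
§1 assembles these into ONE theorem with the single hypothesis `X(h) ∉ 2ℚ^{×2}` (`twoDivides_blockFree_of_generator_of_facts`; no `#Sel₂`/`#Sel₄`/`thm11`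
needed), §2 is the pure-logic reduction of the block-free lower half (in the binder shape of `stub_TwoDividesScriptL` restricted to the family) to the
INVISIBLE stratum — the statement «every generator `h` of `A_n(ℚ)` modulo torsion has `X(h) ∈ 2ℚ^{×2}` ⟹ `2 ∣ 𝓛(n)`», which is `[Z(n)] = 0` /
`P(n) ∈ 2A(ℍ′_n) + tors` there (g18 `BlockFreeStructure.levelTwo_iff_depth_eq_one_of_X_eq_two_mul_sq`; census rows 959, 4223, 7903, 7967, 8119, 9407).

References: [cite: TianYuanZhang2017, §1 (p0002 L101–L110), §3.1 (p0011 L58–L66), Thm. 3.5, Lemma 3.18]; [cite: Darmon2004, Thm. 3.22];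
[cite: SilvermanAEC2009, Prop. X.1.4, X.4.9]; tree `…BlockFreeRho`/`…BlockFreeStructure` (g18), `…GeneratorDepthRhoOne` (g18), `…LowerHalfVisibleSeven` (g16).
-/

noncomputable section

open scoped Classical

open WeierstrassCurve WeierstrassCurve.Affine WeierstrassCurve.Affine.Point
  Literature.NumberTheory.EllipticCurves Literature.NumberTheory.EllipticCurves.TianYuanZhang2017
  Literature.NumberTheory.EllipticCurves.TianYuanZhang2017.W2

set_option autoImplicit false

namespace Summit.BirchSwinnertonDyer.PrintCf2.LowerHalfByName

/-! ## §1 Block-free family: every generator class except `[2]` gives the lower half -/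

/-- **THE LOWER HALF ON THE BLOCK-FREE FAMILY OFF THE INVISIBLE CLASS.**  Granted `tyz_cmPointCompositumData ∧ thm11_parity_of_scriptL ∧ GZK` (the
middle conjunct is not used): for square-free `n ≡ 7 (mod 8)` with no divisor `≡ 5 (mod 8)`, `ord_{s=1} L(E_n, s) = 1`, and a generator `h = (X, Y)` of
`A_n(ℚ)` modulo torsion (`A_n = (congruentNumberCurve n).twoIsogenyCodomain : Y² = X³ + 4n²X`) with `X ∉ 2ℚ^{×2}`: `2 ∣ L` whenever `𝓛(n)² = L²`.
(Cases: `X ∈ ℚ^{×2}` ⟹ `ρ(n) = 1` ⟹ g18's `ρ = 1` lower half; `X ∉ ℚ² ∪ 2ℚ²` ⟹ g16's visible lower half.)  No Selmer hypothesis.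
[cite: TianYuanZhang2017, §1 (p0002 L101–L110), §3.1 (p0011 L58–L66), Thm. 3.5, Lemma 3.18] [cite: Darmon2004, Thm. 3.22] -/
theorem twoDivides_blockFree_of_generator_of_facts
    (hF : tyz_cmPointCompositumData ∧ thm11_parity_of_scriptL ∧ rank_eq_analyticRank_of_analyticRank_le_one)
    (n : ℕ) [(congruentNumberCurve n).IsElliptic]
    (hsq : Squarefree n) (h7 : n % 8 = 7) (hnb : ∀ d ∈ n.divisors, d % 8 ≠ 5) (hr : (congruentNumberCurve n).analyticRank = 1)
    {X Y : ℚ} (h : ((congruentNumberCurve n).twoIsogenyCodomain).toAffine.Nonsingular X Y)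
    (hgen : ∀ P, ∃ m : ℤ, IsOfFinAddOrder (P - m • (Point.some X Y h : ((congruentNumberCurve n).twoIsogenyCodomain).toAffine.Point)))
    (hX : ¬ ∃ s : ℚ, X = 2 * s ^ 2) :
    ∀ L : ℤ, IsScriptL n L → (2 : ℤ) ∣ L := by
  have hGZK := hF.2.2
  have hrank : (congruentNumberCurve n).mordellWeilRank = 1 := (hGZK _ hr.le).1.trans hr
  by_cases hXsq : ∃ q : ℚ, X = q ^ 2
  · have hρ2 : (rhoSubgroup n).index = 2 := BlockFreeStructure.rhoIndex_eq_two_of_X_sq hsq hrank h hgen hXsq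
    exact GeneratorDepth.two_dvd_scriptL_of_rhoIndex_eq_two_of_facts' hF.1 hGZK hsq h7 hnb hr hρ2
  · have hX12 : ¬ ∃ q : ℚ, X = q ^ 2 ∨ X = 2 * q ^ 2 := by
      rintro ⟨q, hq | hq⟩
      · exact hXsq ⟨q, hq⟩
      · exact hX ⟨q, hq⟩
    exact LowerHalfVisible.two_dvd_scriptL_of_visible_of_facts' hF.1 hGZK hsq h7 hnb hr h hgen hX12

/-! ## §2 The exact residual on the block-free family is the invisible class `d(h) = 2` -/

/-- **REDUCTION (block-free family): the lower half of C⁺ there follows, granted the bundle, from the same statement on the INVISIBLE stratum**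
— the `n` every generator `h = (X, Y)` of whose `A_n(ℚ)` modulo torsion has `X ∈ 2ℚ^{×2}` (descent class `d(h) = [2]`; there `[α_n] = 0` and
`2 ∣ 𝓛(n)` is `P(n) ∈ 2A(ℍ′_n) + tors`, g18).  Pure logic with §1; nothing is asserted about the hypothesis `hInv`.
[cite: TianYuanZhang2017, §1, Thm. 3.5, Remark 1.3] [cite: Darmon2004, Thm. 3.22] -/
theorem twoDivides_blockFree_of_facts_of_invisible
    (hF : tyz_cmPointCompositumData ∧ thm11_parity_of_scriptL ∧ rank_eq_analyticRank_of_analyticRank_le_one)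
    (hInv : ∀ (n : ℕ) [(congruentNumberCurve n).IsElliptic] [(congruentNumberCurve n).IsGloballyMinimal],
      Squarefree n → n % 8 = 7 → (∀ d ∈ n.divisors, d % 8 ≠ 5) → (congruentNumberCurve n).analyticRank = 1 →
      Nat.card ((congruentNumberCurve n).selmerGroup 2) = 2 ^ 5 → Nat.card ((congruentNumberCurve n).selmerGroup 4) = 2 ^ 6 →
      (∀ (X Y : ℚ) (h : ((congruentNumberCurve n).twoIsogenyCodomain).toAffine.Nonsingular X Y),
        (∀ P, ∃ m : ℤ, IsOfFinAddOrder (P - m • (Point.some X Y h : ((congruentNumberCurve n).twoIsogenyCodomain).toAffine.Point))) →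
        ∃ s : ℚ, X = 2 * s ^ 2) →
      ∀ L : ℤ, IsScriptL n L → (2 : ℤ) ∣ L) :
    ∀ (n : ℕ) [(congruentNumberCurve n).IsElliptic] [(congruentNumberCurve n).IsGloballyMinimal],
      Squarefree n → n % 8 = 7 → (∀ d ∈ n.divisors, d % 8 ≠ 5) → (congruentNumberCurve n).analyticRank = 1 →
      Nat.card ((congruentNumberCurve n).selmerGroup 2) = 2 ^ 5 → Nat.card ((congruentNumberCurve n).selmerGroup 4) = 2 ^ 6 →
      ∀ L : ℤ, IsScriptL n L → (2 : ℤ) ∣ L := by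
  intro n _ _ hsq h7 hnb hr h2 h4 L hL
  by_cases hex : ∃ (X Y : ℚ) (h : ((congruentNumberCurve n).twoIsogenyCodomain).toAffine.Nonsingular X Y),
      (∀ P, ∃ m : ℤ, IsOfFinAddOrder (P - m • (Point.some X Y h : ((congruentNumberCurve n).twoIsogenyCodomain).toAffine.Point))) ∧
      ¬ ∃ s : ℚ, X = 2 * s ^ 2
  · obtain ⟨X, Y, h, hgen, hX⟩ := hex
    exact twoDivides_blockFree_of_generator_of_facts hF n hsq h7 hnb hr h hgen hX L hL
  · push Not at hex
    exact hInv n hsq h7 hnb hr h2 h4 (fun X Y h hgen => hex X Y h hgen) L hL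

end Summit.BirchSwinnertonDyer.PrintCf2.LowerHalfByName

end
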